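import Summits.Parity.GeneralizedHardyLittlewood.Theorems.PrimeLevelFamEdgeMomentsBeyondDiagonalDiagDecorMult
import HarnessLib

/-!
# Route `PrimeLevelFamEdge`, crux K_A `MomentsBeyondDiagonal` (stmt-Parity-20007), line «petersson_layers» v4, stub `stub_diag`:
# **the master identity for the divisor-log sums on squarefree numbers: `Σ_{d∣k} f(d)g(k/d) = Π_{p∣k}(f(p) + g(p))`
# (census R3(ii), analytic half)**

All divisor-log sums `τ_{α,β}(k) = Σ_{d∣k}(log d)^α(log(k/d))^β` that decorate the general-`Q` Selberg coordinates
(`…DiagLineDecorated`) are `s,t`-jets at `0` of the shifted divisor sums `σ_{s,t}(k) = Σ_{d∣k} d^s(k/d)^t`; on the squarefree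
numbers (the only ones the Möbius coefficients see) these are EULER PRODUCTS over the prime factors, which is the form the
local machinery of the `X²` chain (`KernelFormXSqLocal/Euler`) consumes:

* `sum_divisors_mul_eq_prod_of_squarefree` — **for squarefree `k` and completely multiplicative `f, g`,
  `Σ_{d∣k} f(d)·g(k/d) = Π_{p ∈ primeFactors k}(f(p) + g(p))`** (induction over coprime splittings with
  `…DiagDecorMult.sum_divisors_mul_eq_sum_sum_of_coprime`);
* `sum_divisors_rpow_mul_rpow_of_squarefree` — `σ_{s,t}(k) = Σ_{d∣k} d^s(k/d)^t = Π_{p∣k}(p^s + p^t)` for squarefree `k`,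
  real `s, t` (so `τ(k) = 2^{ω(k)}`, `τ_{1,0} = ∂_sσ|₀ = ½τ log k`, `τ_{1,1} = ∂_s∂_tσ|₀ = τ(log²k − P₂)/4`, …).

Def-free; theorems only. Helper `--supports stmt-Parity-20007`; closes nothing; K_A, K_B and the Parity summit are NOT
proved; nothing about Landau–Siegel zeros.

## References
* E. Kowalski, P. Michel, J. VanderKam, J. reine angew. Math. 526 (2000), (23)–(28) pp. 13–15 (the shifted divisor
  sums of the diagonal residues). [cite: KowalskiMichelVanderKam2000, (23)–(28) — derivation (Euler-product bookkeeping)]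
-/

noncomputable section

open Finset

namespace Summit.Parity.GeneralizedHardyLittlewood.Theorems.MomentsBeyondDiagonal.DiagLines

/-- **`Σ_{d∣k} f(d)g(k/d) = Π_{p∣k}(f(p)+g(p))` for squarefree `k`** and completely multiplicative `f, g`
(`f(1) = g(1) = 1`, `f(ab) = f(a)f(b)`, `g(ab) = g(a)g(b)`). [folklore] -/
theorem sum_divisors_mul_eq_prod_of_squarefree {R : Type*} [CommSemiring R] (f g : ℕ → R)
    (hf1 : f 1 = 1) (hg1 : g 1 = 1) (hf : ∀ a b : ℕ, f (a * b) = f a * f b) (hg : ∀ a b : ℕ, g (a * b) = g a * g b)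
    {k : ℕ} (hk : Squarefree k) :
    ∑ d ∈ k.divisors, f d * g (k / d) = ∏ p ∈ k.primeFactors, (f p + g p) := by
  induction k using Nat.recOnPosPrimePosCoprime with
  | zero => exact absurd hk not_squarefree_zero
  | one => simp [hf1, hg1]
  | prime_pow p n hp hn =>
    have hn1 : n = 1 := ((Nat.squarefree_pow_iff hp.ne_one hn.ne').1 hk).2
    subst hn1
    rw [pow_one, hp.divisors, Finset.sum_pair hp.one_lt.ne, hp.primeFactors, Finset.prod_singleton,
      Nat.div_one, Nat.div_self hp.pos, hf1, hg1, one_mul, mul_one, add_comm]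
  | coprime a b ha hb hab iha ihb =>
    have hsq := Nat.squarefree_mul_iff.1 hk
    rw [sum_divisors_mul_eq_sum_sum_of_coprime hab (fun d e ↦ f d * g e), Nat.Coprime.primeFactors_mul hab,
      Finset.prod_union (Nat.Coprime.disjoint_primeFactors hab), ← iha hsq.2.1, ← ihb hsq.2.2, Finset.sum_mul_sum]
    refine Finset.sum_congr rfl fun a' _ ↦ Finset.sum_congr rfl fun b' _ ↦ ?_
    rw [hf, hg]
    ring

/-- **The shifted divisor sums on squarefree numbers are Euler products**: for squarefree `k` and real `s, t`,
`Σ_{d∣k} d^s·(k/d)^t = Π_{p∣k}(p^s + p^t)`. [folklore] -/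
theorem sum_divisors_rpow_mul_rpow_of_squarefree (s t : ℝ) {k : ℕ} (hk : Squarefree k) :
    ∑ d ∈ k.divisors, (d : ℝ) ^ s * ((k / d : ℕ) : ℝ) ^ t = ∏ p ∈ k.primeFactors, ((p : ℝ) ^ s + (p : ℝ) ^ t) := by
  have h := sum_divisors_mul_eq_prod_of_squarefree (fun d : ℕ ↦ (d : ℝ) ^ s) (fun d : ℕ ↦ (d : ℝ) ^ t)
    (by simp) (by simp)
    (fun a b ↦ by push_cast; exact Real.mul_rpow (Nat.cast_nonneg a) (Nat.cast_nonneg b))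
    (fun a b ↦ by push_cast; exact Real.mul_rpow (Nat.cast_nonneg a) (Nat.cast_nonneg b)) hk
  simpa using h

/-- **`τ(k) = 2^{ω(k)}` for squarefree `k`** (the case `s = t = 0`). [folklore] -/
theorem card_divisors_eq_two_pow_of_squarefree {k : ℕ} (hk : Squarefree k) :
    (k.divisors.card : ℝ) = 2 ^ k.primeFactors.card := by
  have h := sum_divisors_mul_eq_prod_of_squarefree (R := ℝ) (fun _ ↦ 1) (fun _ ↦ 1) rfl rfl
    (fun _ _ ↦ (mul_one _).symm) (fun _ _ ↦ (mul_one _).symm) hk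
  simp only [mul_one, Finset.sum_const, nsmul_eq_mul, Finset.prod_const] at h
  norm_num at h
  exact h

end Summit.Parity.GeneralizedHardyLittlewood.Theorems.MomentsBeyondDiagonal.DiagLines

end
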